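import Summits.CriticalPhenomena.PercolationContinuityZ3.Theorems.PercNearOneGluingNoHeavyPcintBSMRPieces3
import Summits.CriticalPhenomena.PercolationContinuityZ3.Theorems.PercNearOneGluingNoHeavyPcintOSMMono
import HarnessLib

/-!
# PCINT lane, PHASE 12 (plane method, long horizons for `k ≥ 3` time axes): flat continuation of the coefficient tables

Cell `prim-pcint`, seat `prim-pcint-4` (gen 0); memo `run/shared/lean/prim/pcint/T-FIBRE-ROUTE.md` §PHASE 12.

The chunked Green rows of the block-renewal certificates (…PcintBSMRRows, `BSMR.G0H_le_of_chunks`) consume integer upper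
tables `U_i ≥ u k i · DU` and `C_i ≥ cadj k i · DU`, `i < N`, of the oriented meeting probabilities of `k` time axes.  For
`k ≥ 3` the exact rational table `OSM.vrow k M` is affordable in the kernel only up to `M ≈ 300`, while the certificates
want horizons `N = 1000` and more (the Fourier tail `T ∝ 1/N` is the binding constant).  Since `u k ·` is non-increasing
(`OSM.u_antitone`) and `0 ≤ cadj k i ≤ u k i` (`BSM.cadj_bounds`), a table that is exact below `M` and at least `U_{M-1}`
beyond is sound for every horizon: **`BSMR.u_real_flat`**, **`BSMR.cadj_real_flat`**, with the one-pass decidable check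
**`BSMR.flatChk`**.  (By the Markov moment problem nothing sharper follows from finitely many exact values alone; the
numerical loss against exact coefficients is below `10⁻³` in the certificate's spectral radius at `M = 300`, `N = 1000`.)
Nothing here is specific to an instance.
-/

namespace Summit.CriticalPhenomena.PercolationContinuityZ3.Theorems.Pcint.BSMR

open OSM BSM

/-- One linear pass: every entry at a position `≥ M` (position counter started at `i`) is at least `v`. -/
def flatChk (M v : ℕ) : ℕ → List ℕ → Bool
  | _, [] => true
  | i, x :: xs => (decide (i < M) || decide (v ≤ x)) && flatChk M v (i + 1) xs

/-- **The one-pass check, entrywise.** -/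
theorem flatChk_getD {M v : ℕ} : ∀ (i : ℕ) (l : List ℕ), flatChk M v i l = true →
    ∀ j < l.length, M ≤ i + j → v ≤ l.getD j 0
  | i, [], _, j, hj, _ => by simp at hj
  | i, x :: xs, h, 0, _, hM => by
    rw [flatChk, Bool.and_eq_true, Bool.or_eq_true, decide_eq_true_eq, decide_eq_true_eq] at h
    rw [List.getD_cons_zero]
    rcases h.1 with h1 | h1
    · omega
    · exact h1
  | i, x :: xs, h, j + 1, hj, hM => by
    rw [flatChk, Bool.and_eq_true] at h
    rw [List.getD_cons_succ]
    exact flatChk_getD (i + 1) xs h.2 j (by simpa using hj) (by omega)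

/-- **The diagonal coefficients with a flat continuation**: exact values below `M` (`OSM.vrow k M`) and, beyond,
any entries `≥ U_{M-1}` (sound because `u k ·` is non-increasing). -/
theorem u_real_flat {k M N DU : ℕ} {U : List ℕ} (hk : 0 < k) (hM : 0 < M) (hN : N ≤ U.length)
    (h1 : ∀ i ∈ List.range M, uqv (OSM.vrow k M) k i * DU ≤ (U.getD i 0 : ℚ))
    (h2 : flatChk M (U.getD (M - 1) 0) 0 U = true) :
    ∀ i < N, u k i * DU ≤ (U.getD i 0 : ℝ) := by
  intro i hi
  have hex := u_real_of_uqv h1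
  rcases Nat.lt_or_ge i M with h | h
  · exact hex i h
  · have hflat := flatChk_getD 0 U h2 i (by omega) (by omega)
    have hmono : u k i ≤ u k (M - 1) := u_antitone hk (by omega)
    calc u k i * DU ≤ u k (M - 1) * DU := mul_le_mul_of_nonneg_right hmono (Nat.cast_nonneg _)
      _ ≤ (U.getD (M - 1) 0 : ℝ) := hex (M - 1) (by omega)
      _ ≤ (U.getD i 0 : ℝ) := by exact_mod_cast hflat

/-- **The adjacent coefficients with a flat continuation**: exact values below `M` (`OSM.vrow k (M+1)`) and, beyond,
any entries `≥ U_{M-1}` of the diagonal table (sound because `cadj k i ≤ u k i ≤ u k (M-1)`). -/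
theorem cadj_real_flat {k M N DU : ℕ} {U C : List ℕ} (hk : 2 ≤ k) (hM : 0 < M) (hN : N ≤ C.length)
    (hU : ∀ i ∈ List.range M, uqv (OSM.vrow k M) k i * DU ≤ (U.getD i 0 : ℚ))
    (h1 : ∀ i ∈ List.range M, cadjqv (OSM.vrow k (M + 1)) k i * DU ≤ (C.getD i 0 : ℚ))
    (h2 : flatChk M (U.getD (M - 1) 0) 0 C = true) :
    ∀ i < N, cadj k i * DU ≤ (C.getD i 0 : ℝ) := by
  intro i hi
  rcases Nat.lt_or_ge i M with h | h
  · exact cadj_real_of_cadjqv h1 i h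
  · have hflat := flatChk_getD 0 C h2 i (by omega) (by omega)
    have hle : cadj k i ≤ u k (M - 1) :=
      (cadj_bounds hk i).2.trans (u_antitone (by omega) (by omega))
    calc cadj k i * DU ≤ u k (M - 1) * DU := mul_le_mul_of_nonneg_right hle (Nat.cast_nonneg _)
      _ ≤ (U.getD (M - 1) 0 : ℝ) := u_real_of_uqv hU (M - 1) (by omega)
      _ ≤ (C.getD i 0 : ℝ) := by exact_mod_cast hflat

end Summit.CriticalPhenomena.PercolationContinuityZ3.Theorems.Pcint.BSMR
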